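import Summits.QuantumFields.YangMills.Theorems.ColdStartUniversalityLatticeLangevinLiebRobinsonCorrelationLightConeSpaceTime
import Summits.QuantumFields.YangMills.Theorems.ColdStartUniversalityLatticeLangevinLiebRobinsonWordLightCone
import Summits.QuantumFields.YangMills.Theorems.ColdStartUniversalityLatticeLangevinTwoTimeLaw
import HarnessLib

/-!
# Route `ColdStartUniversality` (fixed-cut-off SZZ dynamics; LIEB–ROBINSON / LOCALITY package, file 46):
# ★★★ THE SPACE-TIME LIGHT CONE ALONG EVERY STRONG SOLUTION — `|E[F(U_s)G(U_(s+t))] − E F(U_s)·E G(U_(s+t))|`, every coupling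

Helper file (seat `ym-line-csu-p1`, g33; `--supports stmt-QuantumFields-24809`).  File 43 (`transition_twoTime_covariance_abs_le_lightCone_of_separated`)
bounded the two-time correlation function of the SZZ process READ THROUGH THE SEMIGROUP, `κ_s(F·κ_tG)(x) − κ_sF(x)·κ_(t+s)G(x)`, because the two-time
Markov property of strong solutions was not in the tree.  It now is (files 44–45: `integral_mul_comp_add_eq_integral_mul_transition`,
`integral_mul_comp_add_eq_transition`: `E[F(U_s)G(U_(s+t))] = ∫ F·(κ_tG) dκ_s(x)` for EVERY strong solution from `x` on ANY space), so the light cone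
transfers to the solutions themselves — in particular to the COLD START `U_0 ≡ 1` of the route:
* ★★★ `solution_twoTime_covariance_abs_le_lightCone_of_separated` — `C³` observables `f, g` with link-Lipschitz profiles on link sets at cyclic
  sup-distance `≥ R+1`, every solution `U` from a deterministic start, all lattice times `s, t`:
  `|E[f(U_s)g(U_(s+t))] − E f(U_s)·E g(U_(s+t))| ≤ 576·s·e^(λ(2s+t))·2^(−(R+1))·Σℓ^F·Σℓ^G`, `λ = (1300+4√2)|β'|`;
* ★★★ `wilson_loop_transition_twoTime_covariance_abs_le_lightCone` (kernel form) / `wilson_loop_solution_twoTime_covariance_abs_le_lightCone`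
  (solution form) — two Wilson loop words `w₁, w₂` at distance `≥ R+1`, observed at times `s` and `s+t`:
  `|E[Re tr w₁(U_s)·Re tr w₂(U_(s+t))] − E[Re tr w₁(U_s)]·E[Re tr w₂(U_(s+t))]| ≤ 2304π²|w₁|²|w₂|²·s·e^(λ(2s+t))·2^(−(R+1))`.
From a deterministic start the process is a product state at time `0`; a loop observed at time `s` and a distant loop observed at the later time
`s+t` are uncorrelated until the backward light cones (slope `λ`, the second one `t` longer) overlap — every coupling, every volume, no volume factor.
THEOREMS ONLY, no definition, no sorry; [folklore].  HONEST FRAMING: fixed cut-off; cone slope `λ ∝ |β'|` ⇒ nothing `K`-uniform in physical units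
along `β'_K → ∞`; `UniformColdStartMixing` (24809) is NOT restated; no crux, rung or summit statement is proved; the Yang–Mills mass gap is NOT proved.
-/

set_option autoImplicit false

noncomputable section

namespace Summit.QuantumFields.YangMills.Theorems.ColdStartUniversality.LiebRobinson

open MeasureTheory ProbabilityTheory Matrix Complex Finset Filter Set Metric
open scoped ComplexConjugate BigOperators Matrix NNReal ENNReal Topology
open Literature.Probability.Process Literature.MathematicalPhysics.QuantumFieldTheory
open Literature.MathematicalPhysics.QuantumFieldTheory.Balaban1983to89
open Literature.MathematicalPhysics.QuantumLattice (fundamentalRep fundamentalLatticeRep continuous_fundamentalRep fundamentalRep_apply)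

variable {L : ℕ} [NeZero L]

/-! ## §1. General `C³` observables along a strong solution -/

/-- ★★★ **The space-time light cone along every strong solution from a deterministic start** (any probability space, any flat Brownian driver,
EVERY coupling and volume): for `C³` `f, g` with link-Lipschitz profiles on link sets at cyclic sup-distance `≥ R+1` and all lattice times `s, t`,
`|E[f(U_s)·g(U_(s+t))] − E f(U_s)·E g(U_(s+t))| ≤ 576·s·e^(λ(2s+t))·2^(−(R+1))·Σℓ^F·Σℓ^G` — the two-time Markov property
(`integral_mul_comp_add_eq_transition`) and the kernel-form light cone of file 43. [folklore] -/
theorem solution_twoTime_covariance_abs_le_lightCone_of_separated (L : ℕ) [NeZero L] (β' : ℝ) (s t : ℝ≥0)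
    (x₀ : (GaugeConfig 3 L (Matrix.specialUnitaryGroup (Fin 2) ℂ)))
    (Ω : Type) [MeasurableSpace Ω] (P : Measure Ω) [IsProbabilityMeasure P]
    (W : ℝ≥0 → Ω → (Edge 3 L × NoiseIdx 2 → ℝ)) (hW : IsFlatBrownian W P)
    (U : ℝ≥0 → Ω → (GaugeConfig 3 L (Matrix.specialUnitaryGroup (Fin 2) ℂ))) (hU0 : ∀ ω, U 0 ω = x₀)
    (hU : (latticeLangevinDynamics (fundamentalLatticeRep 2) β').IsSolution (fundamentalRep (Fin 2)) hW.natFiltration P W U)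
    {f : (Edge 3 L × Fin 2 × Fin 2 × Bool → ℝ) → ℝ} (hf : ContDiff ℝ 3 f) {ℓF : Edge 3 L → ℝ} (hℓF : ∀ e, 0 ≤ ℓF e)
    {g : (Edge 3 L × Fin 2 × Fin 2 × Bool → ℝ) → ℝ} (hg : ContDiff ℝ 3 g) {ℓG : Edge 3 L → ℝ} (hℓG : ∀ e, 0 ≤ ℓG e)
    (Λf Λg : Finset (Edge 3 L)) (hΛf : ∀ e, e ∉ Λf → ℓF e = 0) (hΛg : ∀ e, e ∉ Λg → ℓG e = 0) (R : ℕ)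
    (hsep : ∀ e' ∈ Λf, ∀ e ∈ Λg, R + 1 ≤ (Finset.univ.sup fun i : Fin 3 => ((e'.1 i - e.1 i).valMinAbs).natAbs)) :
    let coords : GaugeConfig 3 L (Matrix.specialUnitaryGroup (Fin 2) ℂ) → (Edge 3 L × Fin 2 × Fin 2 × Bool → ℝ) :=
      fun V q => (fun z : ℂ => if q.2.2.2 then z.im else z.re)
        ((fundamentalRep (Fin 2) (V q.1) : Matrix (Fin 2) (Fin 2) ℂ) q.2.1 q.2.2.1)
    (∀ (e : Edge 3 L) (y y' : (GaugeConfig 3 L (Matrix.specialUnitaryGroup (Fin 2) ℂ))), (∀ f', f' ≠ e → y f' = y' f') →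
      |f (coords y) - f (coords y')| ≤ ℓF e * frobNorm ((y e : Matrix (Fin 2) (Fin 2) ℂ) - (y' e : Matrix (Fin 2) (Fin 2) ℂ))) →
    (∀ (e : Edge 3 L) (y y' : (GaugeConfig 3 L (Matrix.specialUnitaryGroup (Fin 2) ℂ))), (∀ f', f' ≠ e → y f' = y' f') →
      |g (coords y) - g (coords y')| ≤ ℓG e * frobNorm ((y e : Matrix (Fin 2) (Fin 2) ℂ) - (y' e : Matrix (Fin 2) (Fin 2) ℂ))) →
    |(∫ ω, f (coords (U s ω)) * g (coords (U (s + t) ω)) ∂P) - (∫ ω, f (coords (U s ω)) ∂P) * (∫ ω, g (coords (U (s + t) ω)) ∂P)| ≤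
      576 * (s : ℝ) * Real.exp ((|β'| * (4 + 4 * Real.sqrt 2 + 12 * 108)) * (2 * (s : ℝ) + (t : ℝ))) * ((2 : ℝ)⁻¹) ^ (R + 1) * (∑ e : Edge 3 L, ℓF e) * (∑ e : Edge 3 L, ℓG e) := by
  intro coords hLf hLg
  classical
  haveI := secondCountableTopology_su2
  haveI := borelSpace_config L
  obtain ⟨κ, hκ, -, hreal⟩ := exists_transitionKernel L β'
  haveI := hκ
  have h := transition_twoTime_covariance_abs_le_lightCone_of_separated L β' κ hreal hf hℓF hg hℓG Λf Λg hΛf hΛg R hsep s t x₀ hLf hLg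
  have hmU : ∀ u : ℝ≥0, Measurable (U u) := fun u => (hU.adapted u).mono (hW.natFiltration.le u) le_rfl
  have hco : Continuous coords := continuous_coords (L := L)
  have hFc : Continuous fun y : (GaugeConfig 3 L (Matrix.specialUnitaryGroup (Fin 2) ℂ)) => f (coords y) := hf.continuous.comp hco
  have hGc : Continuous fun y : (GaugeConfig 3 L (Matrix.specialUnitaryGroup (Fin 2) ℂ)) => g (coords y) := hg.continuous.comp hco
  obtain ⟨CF, hCF⟩ : ∃ C : ℝ, ∀ y : (GaugeConfig 3 L (Matrix.specialUnitaryGroup (Fin 2) ℂ)), |f (coords y)| ≤ C := by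
    set Fb := BoundedContinuousFunction.mkOfCompact ⟨fun y => f (coords y), hFc⟩ with hFbdef
    exact ⟨‖Fb‖, fun y => by simpa [hFbdef, Real.norm_eq_abs] using Fb.norm_coe_le_norm y⟩
  obtain ⟨CG, hCG⟩ : ∃ C : ℝ, ∀ y : (GaugeConfig 3 L (Matrix.specialUnitaryGroup (Fin 2) ℂ)), |g (coords y)| ≤ C := by
    set Gb := BoundedContinuousFunction.mkOfCompact ⟨fun y => g (coords y), hGc⟩ with hGbdef
    exact ⟨‖Gb‖, fun y => by simpa [hGbdef, Real.norm_eq_abs] using Gb.norm_coe_le_norm y⟩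
  have e1 : ∫ ω, f (coords (U s ω)) * g (coords (U (s + t) ω)) ∂P = ∫ y, f (coords y) * (∫ z, g (coords z) ∂(κ t y)) ∂(κ s x₀) :=
    integral_mul_comp_add_eq_transition β' κ hreal x₀ hW hU0 hU s t hFc.measurable hCF hGc.measurable hCG
  have e2 : ∫ y, f (coords y) ∂(κ s x₀) = ∫ ω, f (coords (U s ω)) ∂P := by
    rw [hreal s x₀ Ω P W hW U hU0 hU, integral_map (hmU s).aemeasurable hFc.measurable.aestronglyMeasurable]
  have e3 : ∫ z, g (coords z) ∂(κ (t + s) x₀) = ∫ ω, g (coords (U (s + t) ω)) ∂P := by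
    rw [add_comm t s, hreal (s + t) x₀ Ω P W hW U hU0 hU, integral_map (hmU (s + t)).aemeasurable hGc.measurable.aestronglyMeasurable]
  rw [e1, ← e2, ← e3]
  exact h

/-! ## §2. Wilson loops at two times -/

/-- ★★★ **Two Wilson loops at two times, kernel form**: for loop words `w₁, w₂` at cyclic sup-distance `≥ R+1`, every realising kernel family,
all lattice times `s, t` and EVERY start `x`:
`|κ_s(Re tr w₁ · κ_t Re tr w₂)(x) − κ_s Re tr w₁(x)·κ_(t+s) Re tr w₂(x)| ≤ 2304π²·|w₁|²·|w₂|²·s·e^(λ(2s+t))·2^(−(R+1))`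
(file 43 with the word profiles `2π|w|` of `word_linkLipschitz_profile`). [folklore] -/
theorem wilson_loop_transition_twoTime_covariance_abs_le_lightCone (L : ℕ) [NeZero L] (β' : ℝ)
    (κ : ℝ≥0 → Kernel (GaugeConfig 3 L (Matrix.specialUnitaryGroup (Fin 2) ℂ))
      (GaugeConfig 3 L (Matrix.specialUnitaryGroup (Fin 2) ℂ))) [∀ t, IsMarkovKernel (κ t)]
    (hreal : ∀ (t : ℝ≥0) (x : GaugeConfig 3 L (Matrix.specialUnitaryGroup (Fin 2) ℂ))
        (Ω : Type) [MeasurableSpace Ω] (P : Measure Ω) [IsProbabilityMeasure P]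
        (W : ℝ≥0 → Ω → (Edge 3 L × NoiseIdx 2 → ℝ)) (hW : IsFlatBrownian W P)
        (U : ℝ≥0 → Ω → GaugeConfig 3 L (Matrix.specialUnitaryGroup (Fin 2) ℂ)),
        (∀ ω, U 0 ω = x) →
        (latticeLangevinDynamics (fundamentalLatticeRep 2) β').IsSolution (fundamentalRep (Fin 2))
          hW.natFiltration P W U →
        κ t x = P.map (U t))
    (l₁ l₂ : List (Edge 3 L × Bool)) (R : ℕ)
    (hsep : ∀ e' ∈ (l₁.map Prod.fst).toFinset, ∀ e ∈ (l₂.map Prod.fst).toFinset, R + 1 ≤ (Finset.univ.sup fun i : Fin 3 => ((e'.1 i - e.1 i).valMinAbs).natAbs))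
    (s t : ℝ≥0) (x : (GaugeConfig 3 L (Matrix.specialUnitaryGroup (Fin 2) ℂ))) :
    let coords : GaugeConfig 3 L (Matrix.specialUnitaryGroup (Fin 2) ℂ) → (Edge 3 L × Fin 2 × Fin 2 × Bool → ℝ) :=
      fun V q => (fun z : ℂ => if q.2.2.2 then z.im else z.re)
        ((fundamentalRep (Fin 2) (V q.1) : Matrix (Fin 2) (Fin 2) ℂ) q.2.1 q.2.2.1)
    |(∫ y, (fun y : (Edge 3 L × Fin 2 × Fin 2 × Bool → ℝ) => ((l₁.map (fun a : Edge 3 L × Bool => if a.2 then ((fun (ee : Edge 3 L) => Matrix.of fun (i j : Fin 2) => ((y (ee, i, j, false) : ℝ) : ℂ) + ((y (ee, i, j, true) : ℝ) : ℂ) * Complex.I) a.1)ᴴ else (fun (ee : Edge 3 L) => Matrix.of fun (i j : Fin 2) => ((y (ee, i, j, false) : ℝ) : ℂ) + ((y (ee, i, j, true) : ℝ) : ℂ) * Complex.I) a.1)).prod).trace.re) (coords y) * (∫ z, (fun y : (Edge 3 L × Fin 2 × Fin 2 × Bool → ℝ) => ((l₂.map (fun a : Edge 3 L × Bool => if a.2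 then ((fun (ee : Edge 3 L) => Matrix.of fun (i j : Fin 2) => ((y (ee, i, j, false) : ℝ) : ℂ) + ((y (ee, i, j, true) : ℝ) : ℂ) * Complex.I) a.1)ᴴ else (fun (ee : Edge 3 L) => Matrix.of fun (i j : Fin 2) => ((y (ee, i, j, false) : ℝ) : ℂ) + ((y (ee, i, j, true) : ℝ) : ℂ) * Complex.I) a.1)).prod).trace.re) (coords z) ∂(κ t y)) ∂(κ s x)) -
        (∫ y, (fun y : (Edge 3 L × Fin 2 × Fin 2 × Bool → ℝ) => ((l₁.map (fun a : Edge 3 L × Bool => if a.2 then ((fun (ee : Edge 3 L) => Matrix.of fun (i j : Fin 2) => ((y (ee, i, j, false) : ℝ) : ℂ) + ((y (ee, i, j, true) : ℝ) : ℂ) * Complex.I) a.1)ᴴ else (fun (ee : Edge 3 L) => Matrix.of fun (i j : Fin 2) => ((y (ee, i, j, false) : ℝ) : ℂ) + ((y (ee, i, j, true) : ℝ) : ℂ) * Complex.I) a.1)).prod).trace.re) (coords y) ∂(κ s x)) * (∫ z, (fun y : (Edge 3 L × Fin 2 × Fin 2 × Bool → ℝ) => ((l₂.map (fun a : Edge 3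 L × Bool => if a.2 then ((fun (ee : Edge 3 L) => Matrix.of fun (i j : Fin 2) => ((y (ee, i, j, false) : ℝ) : ℂ) + ((y (ee, i, j, true) : ℝ) : ℂ) * Complex.I) a.1)ᴴ else (fun (ee : Edge 3 L) => Matrix.of fun (i j : Fin 2) => ((y (ee, i, j, false) : ℝ) : ℂ) + ((y (ee, i, j, true) : ℝ) : ℂ) * Complex.I) a.1)).prod).trace.re) (coords z) ∂(κ (t + s) x))| ≤
      2304 * Real.pi ^ 2 * (l₁.length : ℝ) ^ 2 * (l₂.length : ℝ) ^ 2 * ((s : ℝ) * Real.exp ((|β'| * (4 + 4 * Real.sqrt 2 + 12 * 108)) * (2 * (s : ℝ) + (t : ℝ))) * ((2 : ℝ)⁻¹) ^ (R + 1)) := by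
  intro coords
  classical
  set ℓF : Edge 3 L → ℝ := fun e => if e ∈ (l₁.map Prod.fst).toFinset then 2 * Real.pi * (l₁.length : ℝ) else 0 with hℓF
  set ℓG : Edge 3 L → ℝ := fun e => if e ∈ (l₂.map Prod.fst).toFinset then 2 * Real.pi * (l₂.length : ℝ) else 0 with hℓG
  have hℓF0 : ∀ e, 0 ≤ ℓF e := fun e => by
    simp only [hℓF]; split_ifs
    · positivity
    · exact le_rfl
  have hℓG0 : ∀ e, 0 ≤ ℓG e := fun e => by
    simp only [hℓG]; split_ifs
    · positivity
    · exact le_rfl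
  have hΛF : ∀ e, e ∉ (l₁.map Prod.fst).toFinset → ℓF e = 0 := fun e he => by simp only [hℓF, he, if_false]
  have hΛG : ∀ e, e ∉ (l₂.map Prod.fst).toFinset → ℓG e = 0 := fun e he => by simp only [hℓG, he, if_false]
  have hLf := word_linkLipschitz_profile L β' l₁
  have hLg := word_linkLipschitz_profile L β' l₂
  have key := transition_twoTime_covariance_abs_le_lightCone_of_separated L β' κ hreal (contDiff_word (L := L) l₁ (m := 3)) hℓF0
    (contDiff_word (L := L) l₂ (m := 3)) hℓG0 (l₁.map Prod.fst).toFinset (l₂.map Prod.fst).toFinset hΛF hΛG R hsep s t x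
    (fun e y y' h => hLf e y y' h) (fun e y y' h => hLg e y y' h)
  refine key.trans ?_
  have hsum : ∀ (l : List (Edge 3 L × Bool)),
      (∑ e : Edge 3 L, (if e ∈ (l.map Prod.fst).toFinset then 2 * Real.pi * (l.length : ℝ) else 0)) ≤ 2 * Real.pi * (l.length : ℝ) ^ 2 := by
    intro l
    have hcard : (((l.map Prod.fst).toFinset.card : ℕ) : ℝ) ≤ l.length := by
      have h1 := List.toFinset_card_le (l.map Prod.fst)
      rw [List.length_map] at h1
      exact_mod_cast h1
    rw [Finset.sum_ite_mem, Finset.univ_inter, Finset.sum_const, nsmul_eq_mul]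
    calc ((l.map Prod.fst).toFinset.card : ℝ) * (2 * Real.pi * (l.length : ℝ)) ≤ (l.length : ℝ) * (2 * Real.pi * (l.length : ℝ)) :=
        mul_le_mul_of_nonneg_right hcard (by positivity)
      _ = 2 * Real.pi * (l.length : ℝ) ^ 2 := by ring
  have hF := hsum l₁
  have hG := hsum l₂
  have hpre : 0 ≤ 576 * (s : ℝ) * Real.exp ((|β'| * (4 + 4 * Real.sqrt 2 + 12 * 108)) * (2 * (s : ℝ) + (t : ℝ))) * ((2 : ℝ)⁻¹) ^ (R + 1) := by positivity
  have hSF : 0 ≤ ∑ e : Edge 3 L, ℓF e := Finset.sum_nonneg fun e _ => hℓF0 e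
  calc 576 * (s : ℝ) * Real.exp ((|β'| * (4 + 4 * Real.sqrt 2 + 12 * 108)) * (2 * (s : ℝ) + (t : ℝ))) * ((2 : ℝ)⁻¹) ^ (R + 1) * (∑ e : Edge 3 L, ℓF e) * (∑ e : Edge 3 L, ℓG e)
      = 576 * (s : ℝ) * Real.exp ((|β'| * (4 + 4 * Real.sqrt 2 + 12 * 108)) * (2 * (s : ℝ) + (t : ℝ))) * ((2 : ℝ)⁻¹) ^ (R + 1) * ((∑ e : Edge 3 L, ℓF e) * (∑ e : Edge 3 L, ℓG e)) := by ring
    _ ≤ 576 * (s : ℝ) * Real.exp ((|β'| * (4 + 4 * Real.sqrt 2 + 12 * 108)) * (2 * (s : ℝ) + (t : ℝ))) * ((2 : ℝ)⁻¹) ^ (R + 1) * ((2 * Real.pi * (l₁.length : ℝ) ^ 2) * (2 * Real.pi * (l₂.length : ℝ) ^ 2)) :=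
        mul_le_mul_of_nonneg_left (mul_le_mul hF hG (Finset.sum_nonneg fun e _ => hℓG0 e) (by positivity)) hpre
    _ = _ := by ring

/-- ★★★ **Two Wilson loops at two times ALONG EVERY SZZ SOLUTION from a deterministic start — in particular the COLD START `U_0 ≡ 1` of the
route** (any probability space, any flat Brownian driver; EVERY coupling, every volume): for loop words `w₁, w₂` at cyclic sup-distance `≥ R+1`
and all lattice times `s, t`,
`|E[Re tr w₁(U_s)·Re tr w₂(U_(s+t))] − E[Re tr w₁(U_s)]·E[Re tr w₂(U_(s+t))]| ≤ 2304π²·|w₁|²·|w₂|²·s·e^(λ(2s+t))·2^(−(R+1))`.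
The deterministic start is a product state; the loop `w₁` read at time `s` and the distant loop `w₂` read at the LATER time `s+t` stay uncorrelated
until the backward cones meet.  Fixed cut-off; no `K`-uniform content along `β'_K → ∞`; `UniformColdStartMixing` (24809) is NOT restated; the
Yang–Mills mass gap is NOT proved. [folklore] -/
theorem wilson_loop_solution_twoTime_covariance_abs_le_lightCone (L : ℕ) [NeZero L] (β' : ℝ) (s t : ℝ≥0)
    (x₀ : (GaugeConfig 3 L (Matrix.specialUnitaryGroup (Fin 2) ℂ)))
    (Ω : Type) [MeasurableSpace Ω] (P : Measure Ω) [IsProbabilityMeasure P]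
    (W : ℝ≥0 → Ω → (Edge 3 L × NoiseIdx 2 → ℝ)) (hW : IsFlatBrownian W P)
    (U : ℝ≥0 → Ω → (GaugeConfig 3 L (Matrix.specialUnitaryGroup (Fin 2) ℂ))) (hU0 : ∀ ω, U 0 ω = x₀)
    (hU : (latticeLangevinDynamics (fundamentalLatticeRep 2) β').IsSolution (fundamentalRep (Fin 2)) hW.natFiltration P W U)
    (l₁ l₂ : List (Edge 3 L × Bool)) (R : ℕ)
    (hsep : ∀ e' ∈ (l₁.map Prod.fst).toFinset, ∀ e ∈ (l₂.map Prod.fst).toFinset, R + 1 ≤ (Finset.univ.sup fun i : Fin 3 => ((e'.1 i - e.1 i).valMinAbs).natAbs)) :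
    let coords : GaugeConfig 3 L (Matrix.specialUnitaryGroup (Fin 2) ℂ) → (Edge 3 L × Fin 2 × Fin 2 × Bool → ℝ) :=
      fun V q => (fun z : ℂ => if q.2.2.2 then z.im else z.re)
        ((fundamentalRep (Fin 2) (V q.1) : Matrix (Fin 2) (Fin 2) ℂ) q.2.1 q.2.2.1)
    |(∫ ω, (fun y : (Edge 3 L × Fin 2 × Fin 2 × Bool → ℝ) => ((l₁.map (fun a : Edge 3 L × Bool => if a.2 then ((fun (ee : Edge 3 L) => Matrix.of fun (i j : Fin 2) => ((y (ee, i, j, false) : ℝ) : ℂ) + ((y (ee, i, j, true) : ℝ) : ℂ) * Complex.I) a.1)ᴴ else (fun (ee : Edge 3 L) => Matrix.of fun (i j : Fin 2) => ((y (ee, i, j, false) : ℝ) : ℂ) + ((y (ee, i, j, true) : ℝ) : ℂ) * Complex.I) a.1)).prod).trace.re) (coords (U s ω)) * (fun y : (Edge 3 L × Fin 2 × Fin 2 × Bool → ℝ) => ((l₂.map (fun a : Edge 3 L × Bool => if a.2 then ((fun (ee : Edge 3 L) => Matrix.of fun (i j : Fin 2) => ((y (ee, i, j, false) : ℝ) :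 ℂ) + ((y (ee, i, j, true) : ℝ) : ℂ) * Complex.I) a.1)ᴴ else (fun (ee : Edge 3 L) => Matrix.of fun (i j : Fin 2) => ((y (ee, i, j, false) : ℝ) : ℂ) + ((y (ee, i, j, true) : ℝ) : ℂ) * Complex.I) a.1)).prod).trace.re) (coords (U (s + t) ω)) ∂P) -
        (∫ ω, (fun y : (Edge 3 L × Fin 2 × Fin 2 × Bool → ℝ) => ((l₁.map (fun a : Edge 3 L × Bool => if a.2 then ((fun (ee : Edge 3 L) => Matrix.of fun (i j : Fin 2) => ((y (ee, i, j, false) : ℝ) : ℂ) + ((y (ee, i, j, true) : ℝ) : ℂ) * Complex.I) a.1)ᴴ else (fun (ee : Edge 3 L) => Matrix.of fun (i j : Fin 2) => ((y (ee, i, j, false) : ℝ) : ℂ) + ((y (ee, i, j, true) : ℝ) : ℂ) * Complex.I) a.1)).prod).trace.re) (coords (U s ω)) ∂P) * (∫ ω, (fun y : (Edge 3 L × Fin 2 × Fin 2 × Bool → ℝ) => ((l₂.map (fun a : Edge 3 L × Bool => if a.2 then ((fun (ee : Edge 3 L) => Matrix.of fun (i j : Fin 2) => ((y (ee, i, j,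 false) : ℝ) : ℂ) + ((y (ee, i, j, true) : ℝ) : ℂ) * Complex.I) a.1)ᴴ else (fun (ee : Edge 3 L) => Matrix.of fun (i j : Fin 2) => ((y (ee, i, j, false) : ℝ) : ℂ) + ((y (ee, i, j, true) : ℝ) : ℂ) * Complex.I) a.1)).prod).trace.re) (coords (U (s + t) ω)) ∂P)| ≤
      2304 * Real.pi ^ 2 * (l₁.length : ℝ) ^ 2 * (l₂.length : ℝ) ^ 2 * ((s : ℝ) * Real.exp ((|β'| * (4 + 4 * Real.sqrt 2 + 12 * 108)) * (2 * (s : ℝ) + (t : ℝ))) * ((2 : ℝ)⁻¹) ^ (R + 1)) := by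
  intro coords
  classical
  haveI := secondCountableTopology_su2
  haveI := borelSpace_config L
  obtain ⟨κ, hκ, -, hreal⟩ := exists_transitionKernel L β'
  haveI := hκ
  have h := wilson_loop_transition_twoTime_covariance_abs_le_lightCone L β' κ hreal l₁ l₂ R hsep s t x₀
  have hmU : ∀ u : ℝ≥0, Measurable (U u) := fun u => (hU.adapted u).mono (hW.natFiltration.le u) le_rfl
  have hco : Continuous coords := continuous_coords (L := L)
  have hFc : Continuous fun y : (GaugeConfig 3 L (Matrix.specialUnitaryGroup (Fin 2) ℂ)) => (fun y : (Edge 3 L × Fin 2 × Fin 2 × Bool → ℝ) => ((l₁.map (fun a : Edge 3 L × Bool => if a.2 then ((fun (ee : Edge 3 L) => Matrix.of fun (i j : Fin 2) => ((y (ee, i, j, false) : ℝ) : ℂ) + ((y (ee, i, j, true) : ℝ) : ℂ) * Complex.I) a.1)ᴴ else (fun (ee : Edge 3 L) => Matrix.of fun (i j : Fin 2) => ((y (ee, i, j, false) : ℝ) : ℂ) + ((y (ee, i, j, true) : ℝ) : ℂ) * Complex.I) a.1)).prod).trace.re) (coords y) :=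
    ((contDiff_word (L := L) l₁ (m := 3)).continuous.comp hco)
  have hGc : Continuous fun y : (GaugeConfig 3 L (Matrix.specialUnitaryGroup (Fin 2) ℂ)) => (fun y : (Edge 3 L × Fin 2 × Fin 2 × Bool → ℝ) => ((l₂.map (fun a : Edge 3 L × Bool => if a.2 then ((fun (ee : Edge 3 L) => Matrix.of fun (i j : Fin 2) => ((y (ee, i, j, false) : ℝ) : ℂ) + ((y (ee, i, j, true) : ℝ) : ℂ) * Complex.I) a.1)ᴴ else (fun (ee : Edge 3 L) => Matrix.of fun (i j : Fin 2) => ((y (ee, i, j, false) : ℝ) : ℂ) + ((y (ee, i, j, true) : ℝ) : ℂ) * Complex.I) a.1)).prod).trace.re) (coords y) :=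
    ((contDiff_word (L := L) l₂ (m := 3)).continuous.comp hco)
  obtain ⟨CF, hCF⟩ : ∃ C : ℝ, ∀ y : (GaugeConfig 3 L (Matrix.specialUnitaryGroup (Fin 2) ℂ)), |(fun y : (Edge 3 L × Fin 2 × Fin 2 × Bool → ℝ) => ((l₁.map (fun a : Edge 3 L × Bool => if a.2 then ((fun (ee : Edge 3 L) => Matrix.of fun (i j : Fin 2) => ((y (ee, i, j, false) : ℝ) : ℂ) + ((y (ee, i, j, true) : ℝ) : ℂ) * Complex.I) a.1)ᴴ else (fun (ee : Edge 3 L) => Matrix.of fun (i j : Fin 2) => ((y (ee, i, j, false) : ℝ) : ℂ) + ((y (ee, i, j, true) : ℝ) : ℂ) * Complex.I) a.1)).prod).trace.re) (coords y)| ≤ C := by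
    set Fb := BoundedContinuousFunction.mkOfCompact ⟨fun y : (GaugeConfig 3 L (Matrix.specialUnitaryGroup (Fin 2) ℂ)) => (fun y : (Edge 3 L × Fin 2 × Fin 2 × Bool → ℝ) => ((l₁.map (fun a : Edge 3 L × Bool => if a.2 then ((fun (ee : Edge 3 L) => Matrix.of fun (i j : Fin 2) => ((y (ee, i, j, false) : ℝ) : ℂ) + ((y (ee, i, j, true) : ℝ) : ℂ) * Complex.I) a.1)ᴴ else (fun (ee : Edge 3 L) => Matrix.of fun (i j : Fin 2) => ((y (ee, i, j, false) : ℝ) : ℂ) + ((y (ee, i, j, true) : ℝ) : ℂ) * Complex.I) a.1)).prod).trace.re) (coords y), hFc⟩ with hFbdef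
    exact ⟨‖Fb‖, fun y => by simpa [hFbdef, Real.norm_eq_abs] using Fb.norm_coe_le_norm y⟩
  obtain ⟨CG, hCG⟩ : ∃ C : ℝ, ∀ y : (GaugeConfig 3 L (Matrix.specialUnitaryGroup (Fin 2) ℂ)), |(fun y : (Edge 3 L × Fin 2 × Fin 2 × Bool → ℝ) => ((l₂.map (fun a : Edge 3 L × Bool => if a.2 then ((fun (ee : Edge 3 L) => Matrix.of fun (i j : Fin 2) => ((y (ee, i, j, false) : ℝ) : ℂ) + ((y (ee, i, j, true) : ℝ) : ℂ) * Complex.I) a.1)ᴴ else (fun (ee : Edge 3 L) => Matrix.of fun (i j : Fin 2) => ((y (ee, i, j, false) : ℝ) : ℂ) + ((y (ee, i, j, true) : ℝ) : ℂ) * Complex.I) a.1)).prod).trace.re) (coords y)| ≤ C := by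
    set Gb := BoundedContinuousFunction.mkOfCompact ⟨fun y : (GaugeConfig 3 L (Matrix.specialUnitaryGroup (Fin 2) ℂ)) => (fun y : (Edge 3 L × Fin 2 × Fin 2 × Bool → ℝ) => ((l₂.map (fun a : Edge 3 L × Bool => if a.2 then ((fun (ee : Edge 3 L) => Matrix.of fun (i j : Fin 2) => ((y (ee, i, j, false) : ℝ) : ℂ) + ((y (ee, i, j, true) : ℝ) : ℂ) * Complex.I) a.1)ᴴ else (fun (ee : Edge 3 L) => Matrix.of fun (i j : Fin 2) => ((y (ee, i, j, false) : ℝ) : ℂ) + ((y (ee, i, j, true) : ℝ) : ℂ) * Complex.I) a.1)).prod).trace.re) (coords y), hGc⟩ with hGbdef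
    exact ⟨‖Gb‖, fun y => by simpa [hGbdef, Real.norm_eq_abs] using Gb.norm_coe_le_norm y⟩
  have e1 : ∫ ω, (fun y : (Edge 3 L × Fin 2 × Fin 2 × Bool → ℝ) => ((l₁.map (fun a : Edge 3 L × Bool => if a.2 then ((fun (ee : Edge 3 L) => Matrix.of fun (i j : Fin 2) => ((y (ee, i, j, false) : ℝ) : ℂ) + ((y (ee, i, j, true) : ℝ) : ℂ) * Complex.I) a.1)ᴴ else (fun (ee : Edge 3 L) => Matrix.of fun (i j : Fin 2) => ((y (ee, i, j, false) : ℝ) : ℂ) + ((y (ee, i, j, true) : ℝ) : ℂ) * Complex.I) a.1)).prod).trace.re) (coords (U s ω)) * (fun y : (Edge 3 L × Fin 2 × Fin 2 × Bool → ℝ) => ((l₂.map (fun a : Edge 3 L × Bool => if a.2 then ((fun (ee : Edge 3 L) => Matrix.of fun (i j : Fin 2) => ((y (ee, i, j, false) : ℝ) : ℂ) + ((y (ee, i, j, true) : ℝ) : ℂ) * Complex.I) a.1)ᴴ else (fun (ee : Edge 3 L) => Matrix.of fun (i j : Fin 2) => ((y (ee, i, j, false) : ℝ) : ℂ) + ((y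 (ee, i, j, true) : ℝ) : ℂ) * Complex.I) a.1)).prod).trace.re) (coords (U (s + t) ω)) ∂P = ∫ y, (fun y : (Edge 3 L × Fin 2 × Fin 2 × Bool → ℝ) => ((l₁.map (fun a : Edge 3 L × Bool => if a.2 then ((fun (ee : Edge 3 L) => Matrix.of fun (i j : Fin 2) => ((y (ee, i, j, false) : ℝ) : ℂ) + ((y (ee, i, j, true) : ℝ) : ℂ) * Complex.I) a.1)ᴴ else (fun (ee : Edge 3 L) => Matrix.of fun (i j : Fin 2) => ((y (ee, i, j, false) : ℝ) : ℂ) + ((y (ee, i, j, true) : ℝ) : ℂ) * Complex.I) a.1)).prod).trace.re) (coords y) * (∫ z, (fun y : (Edge 3 L × Fin 2 × Fin 2 × Bool → ℝ) => ((l₂.map (fun a : Edge 3 L × Bool => if a.2 then ((fun (ee : Edge 3 L) => Matrix.of fun (i j : Fin 2) => ((y (ee, i, j, false) : ℝ) : ℂ) + ((y (ee, i, j, true) : ℝ) : ℂ) * Complex.I) a.1)ᴴ else (fun (ee : Edge 3 L) => Matrix.of fun (i j : Fin 2) => ((y (ee, i, j, false) : ℝ) : ℂ) + ((y (ee, i,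 j, true) : ℝ) : ℂ) * Complex.I) a.1)).prod).trace.re) (coords z) ∂(κ t y)) ∂(κ s x₀) :=
    integral_mul_comp_add_eq_transition β' κ hreal x₀ hW hU0 hU s t hFc.measurable hCF hGc.measurable hCG
  have e2 : ∫ y, (fun y : (Edge 3 L × Fin 2 × Fin 2 × Bool → ℝ) => ((l₁.map (fun a : Edge 3 L × Bool => if a.2 then ((fun (ee : Edge 3 L) => Matrix.of fun (i j : Fin 2) => ((y (ee, i, j, false) : ℝ) : ℂ) + ((y (ee, i, j, true) : ℝ) : ℂ) * Complex.I) a.1)ᴴ else (fun (ee : Edge 3 L) => Matrix.of fun (i j : Fin 2) => ((y (ee, i, j, false) : ℝ) : ℂ) + ((y (ee, i, j, true) : ℝ) : ℂ) * Complex.I) a.1)).prod).trace.re) (coords y) ∂(κ s x₀) = ∫ ω, (fun y : (Edge 3 L × Fin 2 × Fin 2 × Bool → ℝ) => ((l₁.map (fun a : Edge 3 L × Bool => if a.2 then ((fun (ee : Edge 3 L) => Matrix.of fun (i j : Fin 2) => ((y (ee, i, j, false) : ℝ) : ℂ) + ((y (ee, i, j, true) : ℝ) : ℂ) * Complex.I)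 a.1)ᴴ else (fun (ee : Edge 3 L) => Matrix.of fun (i j : Fin 2) => ((y (ee, i, j, false) : ℝ) : ℂ) + ((y (ee, i, j, true) : ℝ) : ℂ) * Complex.I) a.1)).prod).trace.re) (coords (U s ω)) ∂P := by
    rw [hreal s x₀ Ω P W hW U hU0 hU, integral_map (hmU s).aemeasurable hFc.measurable.aestronglyMeasurable]
  have e3 : ∫ z, (fun y : (Edge 3 L × Fin 2 × Fin 2 × Bool → ℝ) => ((l₂.map (fun a : Edge 3 L × Bool => if a.2 then ((fun (ee : Edge 3 L) => Matrix.of fun (i j : Fin 2) => ((y (ee, i, j, false) : ℝ) : ℂ) + ((y (ee, i, j, true) : ℝ) : ℂ) * Complex.I) a.1)ᴴ else (fun (ee : Edge 3 L) => Matrix.of fun (i j : Fin 2) => ((y (ee, i, j, false) : ℝ) : ℂ) + ((y (ee, i, j, true) : ℝ) : ℂ) * Complex.I) a.1)).prod).trace.re) (coords z) ∂(κ (t + s) x₀) = ∫ ω, (fun y : (Edge 3 L × Fin 2 × Fin 2 × Bool → ℝ) => ((l₂.map (fun a : Edge 3 L × Bool => if a.2 then ((fun (ee : Edge 3 L) =>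 Matrix.of fun (i j : Fin 2) => ((y (ee, i, j, false) : ℝ) : ℂ) + ((y (ee, i, j, true) : ℝ) : ℂ) * Complex.I) a.1)ᴴ else (fun (ee : Edge 3 L) => Matrix.of fun (i j : Fin 2) => ((y (ee, i, j, false) : ℝ) : ℂ) + ((y (ee, i, j, true) : ℝ) : ℂ) * Complex.I) a.1)).prod).trace.re) (coords (U (s + t) ω)) ∂P := by
    rw [add_comm t s, hreal (s + t) x₀ Ω P W hW U hU0 hU, integral_map (hmU (s + t)).aemeasurable hGc.measurable.aestronglyMeasurable]
  rw [e1, ← e2, ← e3]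
  exact h

end Summit.QuantumFields.YangMills.Theorems.ColdStartUniversality.LiebRobinson

end
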